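import Summits.ABC.IUTFork.Conditional.HexDepthLocalTypeSharp
import Summits.ABC.IUTFork.Cor312GenuineKLocalTypeThirty
import HarnessLib

/-!
# Branch C / R-W «GENUINE-NEG» at the EXACT TATE TYPE `e ∣ 30·l` — UNCONDITIONAL: the HEX datum `λ_k = 1/2 + 2/7^k` is decided on the
# refuted side for every `k ≥ 13` and every prime `11 ≤ l ≤ 3361`, for `k = 12` at `11 ≤ l ≤ 480` (the boundary row `(12, 11)` included),
# `k = 11` at `17 ≤ l ≤ 480`, `k = 10` at `23 ≤ l ≤ 67`, `k = 9` at `l ∈ {53, 59, 61, 67}`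

PROOF-ONLY file (0 definitions, 0 `Prop` facts, no instance, no notation) of the abc-iut cell (seat abc-iut-W-neg-2, gen 0; D-0079 rescue
sub-cell R-W; plan g9 18:12:16Z / 18:21:53Z «W-neg-2's engine takes hloc30; residual rows (12,11)/(11,13)/(11,37…61)»). TAKES NO SIDE on
[IUTchIII] Cor. 3.12 (S. Mochizuki, *Inter-universal Teichmüller theory III*, RIMS manuscript, Cor. 3.12 p. 173–174, Step (xi-f) p. 184)
or on any author.

INPUT (one application each; nothing restated): abc-iut-W-neg-1's exact Tate local type at `7` — `GenuineK.absRamificationIdx_kOf_le_thirty_mul_lamSeven`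
(`Cor312GenuineKLocalTypeThirty`, on `Cor22.ramificationIdx_subThetaField_dvd_thirty` p461051: cyclic tame inertia of `F ⊆ F‡ = ℚ(√−1, √λ, √(λ−1), E_λ[15])`
at `7` has order dividing `30`, and `e(x₀|v) ∣ l`): **`e(K_{x₀}/ℚ_7) ≤ 30·l` at every place `x₀ | 7`** of a genuine Θ-volume datum over
`(ratPoint λ_k, l)`. Fed into this seat's engines: p458737 `GenuineK.…_of_ramification_le` (budget `n + 6/5 − 1/e`) with the windows of
`HexDepthLocalTypeSharp` §2 (`n = 3 ⇔ l ≤ 68`, `n = 4 ⇔ l ≤ 480`, `n = 5 ⇔ l ≤ 3361`), and the sharp-budget engine `…_of_ramification_le_sharp`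
(budget `n + 6/5 − 6/(5e)`) at the boundary row `(12, 11)`, `E = 330`.

* §1 `HexLocalType.exists_deep_place_lamSeven_thirty` / `HexLocalType.not_pilotKummerCompatHull_lamSeven_thirty` — EVERY `k ≥ 13`, EVERY prime
  `11 ≤ l ≤ 3361` (extends `HexDepthLocalTypeUnconditional`'s `l ≤ 1680`).
* §2 `HexLocalType.exists_deep_place_lamSeven_thirty_frontier` / `HexLocalType.not_pilotKummerCompatHull_lamSeven_thirty_frontier` — `k = 12` at
  `13 ≤ l ≤ 480`; `k = 11` at `17 ≤ l ≤ 480` (closes the plan's residual rows `(11, 37…61)`); `k = 10` at `23 ≤ l ≤ 67`; `k = 9` at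
  `l ∈ {53, 59, 61, 67}` (new classes below the previous frontier `k = 10`).
* §3 `HexLocalType.exists_deep_place_lamSeven_twelve_eleven` / `HexLocalType.not_pilotKummerCompatHull_lamSeven_twelve_eleven` — the boundary
  row `(k, l) = (12, 11)`: exactly the row that `e ∣ 60·l` cannot decide (`288/11` equality at `e = 660`) and `e ∣ 30·l` can (`1 902 120 < 1 902 384`).
KERNEL HEX FRONTIER after this file (refuted side, top-label packet over `7`, input `e ∣ 30·l`): `12 @ l = 11`, `12 @ l = 13`, `11 @ 17 ≤ l ≤ 480`,
`10 @ 23 ≤ l ≤ 67`, `9 @ {53, 59, 61, 67}`; what is NOT decided by any bound `≥ 30·l` with the [LIN] engine: `(11, 13)` (the genuine type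
`e(v|7) = 30` gives `e = 390 ≥ 294`, `d + a + b = 4.2 − 2/390 > 4.088`) — the numerics' «SOME» row — and every `k ≤ 8`, `k = 9` off the four
primes, `k = 10` at `l ≤ 19`, `k = 11` at `l ≤ 13`: WINDOW for this engine.

HONEST SCOPE: SHARP reading; the per-label licence is a STRONGER-THAN-PRINT sufficient form of (xi-f); a deep top-label packet says NOTHING about
the printed GLOBAL inequality, the number-level `Cor22.Cor312AtDatum`, or any author's intended hull; HEX rows are Szpiro-GOOD (abc-iut-c312-d1):
they test the WINDOW binder `hSHw` of the uncut records (p447945 / p444039) per datum and consume no hypothesis of the Szpiro-bad cut certificates;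
admissibility `CondP6` of `(λ_k, l)` is NOT asserted (the theorems hold at every datum `T`); no side taken on any author; typed ≠ proved;
refuted-as-typed ≠ refuted-in-print; no abc claim.
[cite: Mochizuki2012, IUTchIII Cor. 3.12 Step (xi-f) p. 184; IUTchIV Prop. 1.2 p. 10, Prop. 1.8 (vii) p. 19, Thm. 1.10 Steps (ii)–(iii) p. 24–26]
[cite: SerreLocalFields1979, Ch. III §6 Prop. 13; Ch. IV §2 Cor. 1] [claim: Mochizuki2012, status: disputed] for every IUT quotation.
-/

noncomputable section

open Set Function NumberField IsDedekindDomain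

namespace Summit.ABC.IUTFork.Conditional.HexLocalType

open Thm311 Thm311.Real Cor312 Cor312Vol Cor312Prov Literature.IUT.LogThetaLattice Literature.IUT.LogVolume
  Literature.IUT.HodgeTheaters Literature.IUT.LogVolume.ThetaData
  Literature.NumberTheory.NumberFields Literature.NumberTheory.DiophantineGeometry.GenEll
  Literature.NumberTheory.DiophantineGeometry Summit.ABC.ABC.Theorems

/-! ## §1. Every `k ≥ 13`, every prime `11 ≤ l ≤ 3361` -/

/-- **GENUINE-NEG at the exact Tate type (depth form), UNCONDITIONAL: every `k ≥ 13`, every prime `11 ≤ l ≤ 3361`.** At EVERY genuine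
Θ-volume datum `T` over `(ratPoint λ_k, l)` the top label over `7` is deep at the CHOSEN realising q-idele —
`GenuineK.exists_deep_place_lamSeven_of_ramification_le` at `E := 30·l` (`GenuineK.absRamificationIdx_kOf_le_thirty_mul_lamSeven`) with the
window of `exists_window_thirty`. [cite: Mochizuki2012, IUTchIII Cor. 3.12 Step (xi-f) p. 184; IUTchIV Prop. 1.2 p. 10] [claim: Mochizuki2012, status: disputed] -/
theorem exists_deep_place_lamSeven_thirty {k l : ℕ} (hk : 13 ≤ k) (hl : l.Prime) (h11 : 11 ≤ l) (h3361 : l ≤ 3361)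
    (T : Cor22.ThetaVolumeDatumAt (ratPoint ((2 : ℚ)⁻¹ + 2 / 7 ^ k)) l) :
    letI := T.instFieldF; letI := T.instNumberFieldF; letI := T.instAlgebraF; letI := T.instFieldK
    letI := T.instNumberFieldK; letI := T.instAlgebraK; letI := T.instFieldFbar; letI := T.instAlgebraFbar
    letI := T.instAlgebraKFbar; letI := T.instIsElliptic
    haveI : Fact (Nat.Prime 7) := ⟨by norm_num⟩
    ∃ (i : Fin (thetaIndex (pilotDataOfK T.D T.K)).lstar) (x₀ : (thetaIndex (pilotDataOfK T.D T.K)).Fibre (.inr ⟨7, by norm_num⟩)),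
      (i : ℕ) = (l - 1) / 2 - 1 ∧
      placeOf (pilotDataOfK T.D T.K) 7 x₀ ∈ (pilotDataOfK T.D T.K).S ∧
      (7 : ℝ) ^ ((((i : ℕ) : ℝ) + 2) * (differentOrd 7 (kOf (pilotDataOfK T.D T.K) 7 x₀)
          + logRadiusA 7 (absRamificationIdx 7 (kOf (pilotDataOfK T.D T.K) 7 x₀))
          + logRadiusB 7 (absRamificationIdx 7 (kOf (pilotDataOfK T.D T.K) 7 x₀))) + 1) *
        ‖(exists_realising_qIdeles_pilotDataOfK T.D).choose ⟨7, by norm_num⟩ x₀‖ ^ (((i : ℕ) + 1) ^ 2 - 1) < 1 := by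
  obtain ⟨n, hn, hkl⟩ := exists_window_thirty hk h11 h3361
  exact GenuineK.exists_deep_place_lamSeven_of_ramification_le (E := 30 * l) (by omega) hl h11 hn hkl T
    (GenuineK.absRamificationIdx_kOf_le_thirty_mul_lamSeven (by omega) h11 T)

/-- **GENUINE-NEG at the exact Tate type, UNCONDITIONAL: S_H FAILS at every datum over `(λ_k, l)` for every `k ≥ 13` and every prime
`11 ≤ l ≤ 3361`** — every choice of the free context binders and Kummer data; CHOSEN realising ideles, PINNED reading (the per-datum instance
of `hSHw` of `abc_of_SH_v10K_window`). [cite: Mochizuki2012, IUTchIII Cor. 3.12 Step (xi-f) p. 184] [claim: Mochizuki2012, status: disputed] -/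
theorem not_pilotKummerCompatHull_lamSeven_thirty {k l : ℕ} (hk : 13 ≤ k) (hl : l.Prime) (h11 : 11 ≤ l) (h3361 : l ≤ 3361)
    (T : Cor22.ThetaVolumeDatumAt (ratPoint ((2 : ℚ)⁻¹ + 2 / 7 ^ k)) l) :
    letI := T.instFieldF; letI := T.instNumberFieldF; letI := T.instAlgebraF; letI := T.instFieldK
    letI := T.instNumberFieldK; letI := T.instAlgebraK; letI := T.instFieldFbar; letI := T.instAlgebraFbar
    letI := T.instAlgebraKFbar; letI := T.instIsElliptic
    ∀ (M : Type) [Field M] [NumberField M]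
      (archPk : ∀ (j : (thetaIndex (pilotDataOfK T.D T.K)).Label) (vQ : (thetaIndex (pilotDataOfK T.D T.K)).VQ),
        Set ((logShellsDH (pilotDataOfK T.D T.K) (analyticLogv T.K)).Packet j vQ))
      (archSub : ∀ (j : (thetaIndex (pilotDataOfK T.D T.K)).Label) (v : (thetaIndex (pilotDataOfK T.D T.K)).V),
        Set ((logShellsDH (pilotDataOfK T.D T.K) (analyticLogv T.K)).Packet j ((thetaIndex (pilotDataOfK T.D T.K)).over v)))
      (Ψ : ℤ → ∀ v : (thetaIndex (pilotDataOfK T.D T.K)).V, v ∈ (thetaIndex (pilotDataOfK T.D T.K)).Vbad →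
        Set ((logShellsDH (pilotDataOfK T.D T.K) (analyticLogv T.K)).StarPacket v))
      (act : ℤ → ∀ v : (thetaIndex (pilotDataOfK T.D T.K)).V, v ∈ (thetaIndex (pilotDataOfK T.D T.K)).Vbad →
        (logShellsDH (pilotDataOfK T.D T.K) (analyticLogv T.K)).StarPacket v →
          Module.End ℚ ((logShellsDH (pilotDataOfK T.D T.K) (analyticLogv T.K)).StarPacket v))
      (Mmod : ℤ → ∀ j : (thetaIndex (pilotDataOfK T.D T.K)).LabelStar,
        Set ((logShellsDH (pilotDataOfK T.D T.K) (analyticLogv T.K)).GlobalPacket j.1))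
      (region : ℤ → ∀ j : (thetaIndex (pilotDataOfK T.D T.K)).LabelStar, FinDivisor M →
        ∀ vQ : (thetaIndex (pilotDataOfK T.D T.K)).VQ, Set ((logShellsDH (pilotDataOfK T.D T.K) (analyticLogv T.K)).Packet j.1 vQ))
      (frobAdm : ℤ → ℤ → ∀ (j : (thetaIndex (pilotDataOfK T.D T.K)).Label) (vQ : (thetaIndex (pilotDataOfK T.D T.K)).VQ),
        Set ((logShellsDH (pilotDataOfK T.D T.K) (analyticLogv T.K)).Packet j vQ) → Prop)
      (frobLogvol : ℤ → ℤ → ∀ (j : (thetaIndex (pilotDataOfK T.D T.K)).Label) (vQ : (thetaIndex (pilotDataOfK T.D T.K)).VQ),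
        Set ((logShellsDH (pilotDataOfK T.D T.K) (analyticLogv T.K)).Packet j vQ) → ℝ)
      (frobΨ : ℤ → ℤ → ∀ v : (thetaIndex (pilotDataOfK T.D T.K)).V, v ∈ (thetaIndex (pilotDataOfK T.D T.K)).Vbad →
        Set ((logShellsDH (pilotDataOfK T.D T.K) (analyticLogv T.K)).StarPacket v))
      (frobMmod : ℤ → ℤ → ∀ j : (thetaIndex (pilotDataOfK T.D T.K)).LabelStar,
        Set ((logShellsDH (pilotDataOfK T.D T.K) (analyticLogv T.K)).GlobalPacket j.1))
      (unitImage : ℤ → ℤ → ℕ → ∀ (j : (thetaIndex (pilotDataOfK T.D T.K)).Label) (vQ : (thetaIndex (pilotDataOfK T.D T.K)).VQ),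
        Set ((logShellsDH (pilotDataOfK T.D T.K) (analyticLogv T.K)).Packet j vQ))
      (ballImage : ℤ → ℤ → ∀ (j : (thetaIndex (pilotDataOfK T.D T.K)).Label) (vQ : (thetaIndex (pilotDataOfK T.D T.K)).VQ),
        Set ((logShellsDH (pilotDataOfK T.D T.K) (analyticLogv T.K)).Packet j vQ))
      (thetaDiv : ℤ → ℤ → LgpDivisor M (thetaIndex (pilotDataOfK T.D T.K)).lstar)
      (n : ℤ) {HT : Type} {LogLink : HT → HT → Type} {IsFull : ∀ {s t : HT}, LogLink s t → Prop}
      (lat : LGPGaussianLogThetaLattice LogLink IsFull)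
      {Frd : Type} {IsoF : Frd → Frd → Type} {Ob : Frd → Type} {realify : Frd → Frd} {Strip : Type}
      {IsoS : Strip → Strip → Type} {Mv : ∀ v : (thetaIndex (pilotDataOfK T.D T.K)).V, v ∈ (thetaIndex (pilotDataOfK T.D T.K)).Vbad → Type}
      [∀ v h, Monoid (Mv v h)]
      (sig : GlobalLGPFrobenioidSignature (thetaIndex (pilotDataOfK T.D T.K)).lstar (thetaIndex (pilotDataOfK T.D T.K)).V
        (· ∈ (thetaIndex (pilotDataOfK T.D T.K)).Vbad) Frd IsoF Ob realify Strip IsoS Mv)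
      (split : SplittingMonoids Mv) {ObΔ : Type}
      {N : ∀ v : (thetaIndex (pilotDataOfK T.D T.K)).V, v ∈ (thetaIndex (pilotDataOfK T.D T.K)).Vbad → Type}
      [∀ v h, Monoid (N v h)] (qData : QPilotData ObΔ N)
      (qK : ∀ v : (thetaIndex (pilotDataOfK T.D T.K)).V, v ∈ (thetaIndex (pilotDataOfK T.D T.K)).Vbad →
        Set ((logShellsDH (pilotDataOfK T.D T.K) (analyticLogv T.K)).StarPacket v)),
    ¬ Cor312Vol.PilotKummerCompatHull
        (LatticeSituation.ofShells (logShellsDH (pilotDataOfK T.D T.K) (analyticLogv T.K)) M archPk archSub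
          (summandPiecesPr (pilotDataOfK T.D T.K) (logvAnalytic_analyticLogv (F := T.K))).Adm
          (summandPiecesPr (pilotDataOfK T.D T.K) (logvAnalytic_analyticLogv (F := T.K))).logvol Ψ act Mmod region frobAdm
          frobLogvol frobΨ frobMmod unitImage ballImage thetaDiv)
        (settingPrVolSharp (pilotDataOfK T.D T.K) (logvAnalytic_analyticLogv (F := T.K)) M archPk archSub Ψ act Mmod region n
          lat sig split qData (exists_realising_qIdeles_pilotDataOfK T.D).choose (exists_realising_thetaIdeles_pilotDataOfK T.D).choose
          (exists_realising_qIdeles_pilotDataOfK T.D).choose_spec.1 (exists_realising_qIdeles_pilotDataOfK T.D).choose_spec.2.1)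
        (fun _ => Cor312.Setting.qRegion
          (settingPrVolSharp (pilotDataOfK T.D T.K) (logvAnalytic_analyticLogv (F := T.K)) M archPk archSub Ψ act Mmod region n
            lat sig split qData (exists_realising_qIdeles_pilotDataOfK T.D).choose (exists_realising_thetaIdeles_pilotDataOfK T.D).choose
            (exists_realising_qIdeles_pilotDataOfK T.D).choose_spec.1 (exists_realising_qIdeles_pilotDataOfK T.D).choose_spec.2.1))
        qK := by
  obtain ⟨n, hn, hkl⟩ := exists_window_thirty hk h11 h3361
  exact GenuineK.not_pilotKummerCompatHull_lamSeven_of_ramification_le (E := 30 * l) (by omega) hl h11 hn hkl T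
    (GenuineK.absRamificationIdx_kOf_le_thirty_mul_lamSeven (by omega) h11 T)

/-! ## §2. Below 13: `k = 12` at `13 ≤ l ≤ 480`, `k = 11` at `17 ≤ l ≤ 480`, `k = 10` at `23 ≤ l ≤ 67`, `k = 9` at `{53, 59, 61, 67}` -/

/-- **GENUINE-NEG frontier at the exact Tate type (depth form), UNCONDITIONAL.** For `k = 12` and prime `13 ≤ l ≤ 480`, `k = 11` and prime
`17 ≤ l ≤ 480`, `k = 10` and prime `23 ≤ l ≤ 67`, or `k = 9` and `l ∈ {53, 59, 61, 67}`: at EVERY genuine Θ-volume datum over `(ratPoint λ_k, l)`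
the top label over `7` is deep at the chosen realising q-idele (`exists_window_thirty_frontier` + `E := 30·l`).
[cite: Mochizuki2012, IUTchIII Cor. 3.12 Step (xi-f) p. 184; IUTchIV Prop. 1.2 p. 10] [claim: Mochizuki2012, status: disputed] -/
theorem exists_deep_place_lamSeven_thirty_frontier {k l : ℕ} (hl : l.Prime)
    (h : (k = 12 ∧ 13 ≤ l ∧ l ≤ 480) ∨ (k = 11 ∧ 17 ≤ l ∧ l ≤ 480) ∨ (k = 10 ∧ 23 ≤ l ∧ l ≤ 67) ∨
      (k = 9 ∧ (l = 53 ∨ l = 59 ∨ l = 61 ∨ l = 67)))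
    (T : Cor22.ThetaVolumeDatumAt (ratPoint ((2 : ℚ)⁻¹ + 2 / 7 ^ k)) l) :
    letI := T.instFieldF; letI := T.instNumberFieldF; letI := T.instAlgebraF; letI := T.instFieldK
    letI := T.instNumberFieldK; letI := T.instAlgebraK; letI := T.instFieldFbar; letI := T.instAlgebraFbar
    letI := T.instAlgebraKFbar; letI := T.instIsElliptic
    haveI : Fact (Nat.Prime 7) := ⟨by norm_num⟩
    ∃ (i : Fin (thetaIndex (pilotDataOfK T.D T.K)).lstar) (x₀ : (thetaIndex (pilotDataOfK T.D T.K)).Fibre (.inr ⟨7, by norm_num⟩)),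
      (i : ℕ) = (l - 1) / 2 - 1 ∧
      placeOf (pilotDataOfK T.D T.K) 7 x₀ ∈ (pilotDataOfK T.D T.K).S ∧
      (7 : ℝ) ^ ((((i : ℕ) : ℝ) + 2) * (differentOrd 7 (kOf (pilotDataOfK T.D T.K) 7 x₀)
          + logRadiusA 7 (absRamificationIdx 7 (kOf (pilotDataOfK T.D T.K) 7 x₀))
          + logRadiusB 7 (absRamificationIdx 7 (kOf (pilotDataOfK T.D T.K) 7 x₀))) + 1) *
        ‖(exists_realising_qIdeles_pilotDataOfK T.D).choose ⟨7, by norm_num⟩ x₀‖ ^ (((i : ℕ) + 1) ^ 2 - 1) < 1 := by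
  have hk : 1 ≤ k := by rcases h with ⟨rfl, -⟩ | ⟨rfl, -⟩ | ⟨rfl, -⟩ | ⟨rfl, -⟩ <;> norm_num
  have h11 : 11 ≤ l := by
    rcases h with ⟨-, h13, -⟩ | ⟨-, h17, -⟩ | ⟨-, h23, -⟩ | ⟨-, rfl | rfl | rfl | rfl⟩ <;> omega
  obtain ⟨n, hn, hkl⟩ := exists_window_thirty_frontier h
  exact GenuineK.exists_deep_place_lamSeven_of_ramification_le (E := 30 * l) hk hl h11 hn hkl T
    (GenuineK.absRamificationIdx_kOf_le_thirty_mul_lamSeven hk h11 T)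

/-- **GENUINE-NEG frontier at the exact Tate type, UNCONDITIONAL: S_H FAILS at every datum over `(λ_k, l)`** for `k = 12`, prime `13 ≤ l ≤ 480`;
`k = 11`, prime `17 ≤ l ≤ 480`; `k = 10`, prime `23 ≤ l ≤ 67`; `k = 9`, `l ∈ {53, 59, 61, 67}` — every choice of the free binders and Kummer data;
chosen realising ideles, pinned reading. [cite: Mochizuki2012, IUTchIII Cor. 3.12 Step (xi-f) p. 184] [claim: Mochizuki2012, status: disputed] -/
theorem not_pilotKummerCompatHull_lamSeven_thirty_frontier {k l : ℕ} (hl : l.Prime)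
    (h : (k = 12 ∧ 13 ≤ l ∧ l ≤ 480) ∨ (k = 11 ∧ 17 ≤ l ∧ l ≤ 480) ∨ (k = 10 ∧ 23 ≤ l ∧ l ≤ 67) ∨
      (k = 9 ∧ (l = 53 ∨ l = 59 ∨ l = 61 ∨ l = 67)))
    (T : Cor22.ThetaVolumeDatumAt (ratPoint ((2 : ℚ)⁻¹ + 2 / 7 ^ k)) l) :
    letI := T.instFieldF; letI := T.instNumberFieldF; letI := T.instAlgebraF; letI := T.instFieldK
    letI := T.instNumberFieldK; letI := T.instAlgebraK; letI := T.instFieldFbar; letI := T.instAlgebraFbar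
    letI := T.instAlgebraKFbar; letI := T.instIsElliptic
    ∀ (M : Type) [Field M] [NumberField M]
      (archPk : ∀ (j : (thetaIndex (pilotDataOfK T.D T.K)).Label) (vQ : (thetaIndex (pilotDataOfK T.D T.K)).VQ),
        Set ((logShellsDH (pilotDataOfK T.D T.K) (analyticLogv T.K)).Packet j vQ))
      (archSub : ∀ (j : (thetaIndex (pilotDataOfK T.D T.K)).Label) (v : (thetaIndex (pilotDataOfK T.D T.K)).V),
        Set ((logShellsDH (pilotDataOfK T.D T.K) (analyticLogv T.K)).Packet j ((thetaIndex (pilotDataOfK T.D T.K)).over v)))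
      (Ψ : ℤ → ∀ v : (thetaIndex (pilotDataOfK T.D T.K)).V, v ∈ (thetaIndex (pilotDataOfK T.D T.K)).Vbad →
        Set ((logShellsDH (pilotDataOfK T.D T.K) (analyticLogv T.K)).StarPacket v))
      (act : ℤ → ∀ v : (thetaIndex (pilotDataOfK T.D T.K)).V, v ∈ (thetaIndex (pilotDataOfK T.D T.K)).Vbad →
        (logShellsDH (pilotDataOfK T.D T.K) (analyticLogv T.K)).StarPacket v →
          Module.End ℚ ((logShellsDH (pilotDataOfK T.D T.K) (analyticLogv T.K)).StarPacket v))
      (Mmod : ℤ → ∀ j : (thetaIndex (pilotDataOfK T.D T.K)).LabelStar,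
        Set ((logShellsDH (pilotDataOfK T.D T.K) (analyticLogv T.K)).GlobalPacket j.1))
      (region : ℤ → ∀ j : (thetaIndex (pilotDataOfK T.D T.K)).LabelStar, FinDivisor M →
        ∀ vQ : (thetaIndex (pilotDataOfK T.D T.K)).VQ, Set ((logShellsDH (pilotDataOfK T.D T.K) (analyticLogv T.K)).Packet j.1 vQ))
      (frobAdm : ℤ → ℤ → ∀ (j : (thetaIndex (pilotDataOfK T.D T.K)).Label) (vQ : (thetaIndex (pilotDataOfK T.D T.K)).VQ),
        Set ((logShellsDH (pilotDataOfK T.D T.K) (analyticLogv T.K)).Packet j vQ) → Prop)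
      (frobLogvol : ℤ → ℤ → ∀ (j : (thetaIndex (pilotDataOfK T.D T.K)).Label) (vQ : (thetaIndex (pilotDataOfK T.D T.K)).VQ),
        Set ((logShellsDH (pilotDataOfK T.D T.K) (analyticLogv T.K)).Packet j vQ) → ℝ)
      (frobΨ : ℤ → ℤ → ∀ v : (thetaIndex (pilotDataOfK T.D T.K)).V, v ∈ (thetaIndex (pilotDataOfK T.D T.K)).Vbad →
        Set ((logShellsDH (pilotDataOfK T.D T.K) (analyticLogv T.K)).StarPacket v))
      (frobMmod : ℤ → ℤ → ∀ j : (thetaIndex (pilotDataOfK T.D T.K)).LabelStar,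
        Set ((logShellsDH (pilotDataOfK T.D T.K) (analyticLogv T.K)).GlobalPacket j.1))
      (unitImage : ℤ → ℤ → ℕ → ∀ (j : (thetaIndex (pilotDataOfK T.D T.K)).Label) (vQ : (thetaIndex (pilotDataOfK T.D T.K)).VQ),
        Set ((logShellsDH (pilotDataOfK T.D T.K) (analyticLogv T.K)).Packet j vQ))
      (ballImage : ℤ → ℤ → ∀ (j : (thetaIndex (pilotDataOfK T.D T.K)).Label) (vQ : (thetaIndex (pilotDataOfK T.D T.K)).VQ),
        Set ((logShellsDH (pilotDataOfK T.D T.K) (analyticLogv T.K)).Packet j vQ))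
      (thetaDiv : ℤ → ℤ → LgpDivisor M (thetaIndex (pilotDataOfK T.D T.K)).lstar)
      (n : ℤ) {HT : Type} {LogLink : HT → HT → Type} {IsFull : ∀ {s t : HT}, LogLink s t → Prop}
      (lat : LGPGaussianLogThetaLattice LogLink IsFull)
      {Frd : Type} {IsoF : Frd → Frd → Type} {Ob : Frd → Type} {realify : Frd → Frd} {Strip : Type}
      {IsoS : Strip → Strip → Type} {Mv : ∀ v : (thetaIndex (pilotDataOfK T.D T.K)).V, v ∈ (thetaIndex (pilotDataOfK T.D T.K)).Vbad → Type}
      [∀ v h, Monoid (Mv v h)]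
      (sig : GlobalLGPFrobenioidSignature (thetaIndex (pilotDataOfK T.D T.K)).lstar (thetaIndex (pilotDataOfK T.D T.K)).V
        (· ∈ (thetaIndex (pilotDataOfK T.D T.K)).Vbad) Frd IsoF Ob realify Strip IsoS Mv)
      (split : SplittingMonoids Mv) {ObΔ : Type}
      {N : ∀ v : (thetaIndex (pilotDataOfK T.D T.K)).V, v ∈ (thetaIndex (pilotDataOfK T.D T.K)).Vbad → Type}
      [∀ v h, Monoid (N v h)] (qData : QPilotData ObΔ N)
      (qK : ∀ v : (thetaIndex (pilotDataOfK T.D T.K)).V, v ∈ (thetaIndex (pilotDataOfK T.D T.K)).Vbad →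
        Set ((logShellsDH (pilotDataOfK T.D T.K) (analyticLogv T.K)).StarPacket v)),
    ¬ Cor312Vol.PilotKummerCompatHull
        (LatticeSituation.ofShells (logShellsDH (pilotDataOfK T.D T.K) (analyticLogv T.K)) M archPk archSub
          (summandPiecesPr (pilotDataOfK T.D T.K) (logvAnalytic_analyticLogv (F := T.K))).Adm
          (summandPiecesPr (pilotDataOfK T.D T.K) (logvAnalytic_analyticLogv (F := T.K))).logvol Ψ act Mmod region frobAdm
          frobLogvol frobΨ frobMmod unitImage ballImage thetaDiv)
        (settingPrVolSharp (pilotDataOfK T.D T.K) (logvAnalytic_analyticLogv (F := T.K)) M archPk archSub Ψ act Mmod region n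
          lat sig split qData (exists_realising_qIdeles_pilotDataOfK T.D).choose (exists_realising_thetaIdeles_pilotDataOfK T.D).choose
          (exists_realising_qIdeles_pilotDataOfK T.D).choose_spec.1 (exists_realising_qIdeles_pilotDataOfK T.D).choose_spec.2.1)
        (fun _ => Cor312.Setting.qRegion
          (settingPrVolSharp (pilotDataOfK T.D T.K) (logvAnalytic_analyticLogv (F := T.K)) M archPk archSub Ψ act Mmod region n
            lat sig split qData (exists_realising_qIdeles_pilotDataOfK T.D).choose (exists_realising_thetaIdeles_pilotDataOfK T.D).choose
            (exists_realising_qIdeles_pilotDataOfK T.D).choose_spec.1 (exists_realising_qIdeles_pilotDataOfK T.D).choose_spec.2.1))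
        qK := by
  have hk : 1 ≤ k := by rcases h with ⟨rfl, -⟩ | ⟨rfl, -⟩ | ⟨rfl, -⟩ | ⟨rfl, -⟩ <;> norm_num
  have h11 : 11 ≤ l := by
    rcases h with ⟨-, h13, -⟩ | ⟨-, h17, -⟩ | ⟨-, h23, -⟩ | ⟨-, rfl | rfl | rfl | rfl⟩ <;> omega
  obtain ⟨n, hn, hkl⟩ := exists_window_thirty_frontier h
  exact GenuineK.not_pilotKummerCompatHull_lamSeven_of_ramification_le (E := 30 * l) hk hl h11 hn hkl T
    (GenuineK.absRamificationIdx_kOf_le_thirty_mul_lamSeven hk h11 T)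

/-! ## §3. The boundary row `(k, l) = (12, 11)` -/

/-- **GENUINE-NEG at `(k, l) = (12, 11)` (depth form), UNCONDITIONAL** — the sharp-budget engine at `E = 330 = 30·11`, `n = 3`
(`sharp_criterion_twelve_eleven`): at every genuine Θ-volume datum over `(ratPoint λ₁₂, 11)` the top label `i = 4` over `7` is deep at the
chosen realising q-idele. [cite: Mochizuki2012, IUTchIII Cor. 3.12 Step (xi-f) p. 184; IUTchIV Prop. 1.2 p. 10] [claim: Mochizuki2012, status: disputed] -/
theorem exists_deep_place_lamSeven_twelve_eleven
    (T : Cor22.ThetaVolumeDatumAt (ratPoint ((2 : ℚ)⁻¹ + 2 / 7 ^ 12)) 11) :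
    letI := T.instFieldF; letI := T.instNumberFieldF; letI := T.instAlgebraF; letI := T.instFieldK
    letI := T.instNumberFieldK; letI := T.instAlgebraK; letI := T.instFieldFbar; letI := T.instAlgebraFbar
    letI := T.instAlgebraKFbar; letI := T.instIsElliptic
    haveI : Fact (Nat.Prime 7) := ⟨by norm_num⟩
    ∃ (i : Fin (thetaIndex (pilotDataOfK T.D T.K)).lstar) (x₀ : (thetaIndex (pilotDataOfK T.D T.K)).Fibre (.inr ⟨7, by norm_num⟩)),
      (i : ℕ) = (11 - 1) / 2 - 1 ∧
      placeOf (pilotDataOfK T.D T.K) 7 x₀ ∈ (pilotDataOfK T.D T.K).S ∧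
      (7 : ℝ) ^ ((((i : ℕ) : ℝ) + 2) * (differentOrd 7 (kOf (pilotDataOfK T.D T.K) 7 x₀)
          + logRadiusA 7 (absRamificationIdx 7 (kOf (pilotDataOfK T.D T.K) 7 x₀))
          + logRadiusB 7 (absRamificationIdx 7 (kOf (pilotDataOfK T.D T.K) 7 x₀))) + 1) *
        ‖(exists_realising_qIdeles_pilotDataOfK T.D).choose ⟨7, by norm_num⟩ x₀‖ ^ (((i : ℕ) + 1) ^ 2 - 1) < 1 :=
  GenuineK.exists_deep_place_lamSeven_of_ramification_le_sharp (k := 12) (l := 11) (n := 3) (E := 30 * 11) (by norm_num) (by norm_num)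
    le_rfl sharp_criterion_twelve_eleven.1 sharp_criterion_twelve_eleven.2 T
    (GenuineK.absRamificationIdx_kOf_le_thirty_mul_lamSeven (by norm_num) le_rfl T)

/-- **GENUINE-NEG at `(k, l) = (12, 11)`, UNCONDITIONAL: S_H FAILS at every datum over `(λ₁₂, 11)`** — every choice of the free binders and
Kummer data; chosen realising ideles, pinned reading. The row that separates the local types `e ∣ 60·l` (undecided: `288/11` equality at
`e = 660`) and `e ∣ 30·l` (decided). [cite: Mochizuki2012, IUTchIII Cor. 3.12 Step (xi-f) p. 184] [claim: Mochizuki2012, status: disputed] -/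
theorem not_pilotKummerCompatHull_lamSeven_twelve_eleven
    (T : Cor22.ThetaVolumeDatumAt (ratPoint ((2 : ℚ)⁻¹ + 2 / 7 ^ 12)) 11) :
    letI := T.instFieldF; letI := T.instNumberFieldF; letI := T.instAlgebraF; letI := T.instFieldK
    letI := T.instNumberFieldK; letI := T.instAlgebraK; letI := T.instFieldFbar; letI := T.instAlgebraFbar
    letI := T.instAlgebraKFbar; letI := T.instIsElliptic
    ∀ (M : Type) [Field M] [NumberField M]
      (archPk : ∀ (j : (thetaIndex (pilotDataOfK T.D T.K)).Label) (vQ : (thetaIndex (pilotDataOfK T.D T.K)).VQ),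
        Set ((logShellsDH (pilotDataOfK T.D T.K) (analyticLogv T.K)).Packet j vQ))
      (archSub : ∀ (j : (thetaIndex (pilotDataOfK T.D T.K)).Label) (v : (thetaIndex (pilotDataOfK T.D T.K)).V),
        Set ((logShellsDH (pilotDataOfK T.D T.K) (analyticLogv T.K)).Packet j ((thetaIndex (pilotDataOfK T.D T.K)).over v)))
      (Ψ : ℤ → ∀ v : (thetaIndex (pilotDataOfK T.D T.K)).V, v ∈ (thetaIndex (pilotDataOfK T.D T.K)).Vbad →
        Set ((logShellsDH (pilotDataOfK T.D T.K) (analyticLogv T.K)).StarPacket v))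
      (act : ℤ → ∀ v : (thetaIndex (pilotDataOfK T.D T.K)).V, v ∈ (thetaIndex (pilotDataOfK T.D T.K)).Vbad →
        (logShellsDH (pilotDataOfK T.D T.K) (analyticLogv T.K)).StarPacket v →
          Module.End ℚ ((logShellsDH (pilotDataOfK T.D T.K) (analyticLogv T.K)).StarPacket v))
      (Mmod : ℤ → ∀ j : (thetaIndex (pilotDataOfK T.D T.K)).LabelStar,
        Set ((logShellsDH (pilotDataOfK T.D T.K) (analyticLogv T.K)).GlobalPacket j.1))
      (region : ℤ → ∀ j : (thetaIndex (pilotDataOfK T.D T.K)).LabelStar, FinDivisor M →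
        ∀ vQ : (thetaIndex (pilotDataOfK T.D T.K)).VQ, Set ((logShellsDH (pilotDataOfK T.D T.K) (analyticLogv T.K)).Packet j.1 vQ))
      (frobAdm : ℤ → ℤ → ∀ (j : (thetaIndex (pilotDataOfK T.D T.K)).Label) (vQ : (thetaIndex (pilotDataOfK T.D T.K)).VQ),
        Set ((logShellsDH (pilotDataOfK T.D T.K) (analyticLogv T.K)).Packet j vQ) → Prop)
      (frobLogvol : ℤ → ℤ → ∀ (j : (thetaIndex (pilotDataOfK T.D T.K)).Label) (vQ : (thetaIndex (pilotDataOfK T.D T.K)).VQ),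
        Set ((logShellsDH (pilotDataOfK T.D T.K) (analyticLogv T.K)).Packet j vQ) → ℝ)
      (frobΨ : ℤ → ℤ → ∀ v : (thetaIndex (pilotDataOfK T.D T.K)).V, v ∈ (thetaIndex (pilotDataOfK T.D T.K)).Vbad →
        Set ((logShellsDH (pilotDataOfK T.D T.K) (analyticLogv T.K)).StarPacket v))
      (frobMmod : ℤ → ℤ → ∀ j : (thetaIndex (pilotDataOfK T.D T.K)).LabelStar,
        Set ((logShellsDH (pilotDataOfK T.D T.K) (analyticLogv T.K)).GlobalPacket j.1))
      (unitImage : ℤ → ℤ → ℕ → ∀ (j : (thetaIndex (pilotDataOfK T.D T.K)).Label) (vQ : (thetaIndex (pilotDataOfK T.D T.K)).VQ),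
        Set ((logShellsDH (pilotDataOfK T.D T.K) (analyticLogv T.K)).Packet j vQ))
      (ballImage : ℤ → ℤ → ∀ (j : (thetaIndex (pilotDataOfK T.D T.K)).Label) (vQ : (thetaIndex (pilotDataOfK T.D T.K)).VQ),
        Set ((logShellsDH (pilotDataOfK T.D T.K) (analyticLogv T.K)).Packet j vQ))
      (thetaDiv : ℤ → ℤ → LgpDivisor M (thetaIndex (pilotDataOfK T.D T.K)).lstar)
      (n : ℤ) {HT : Type} {LogLink : HT → HT → Type} {IsFull : ∀ {s t : HT}, LogLink s t → Prop}
      (lat : LGPGaussianLogThetaLattice LogLink IsFull)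
      {Frd : Type} {IsoF : Frd → Frd → Type} {Ob : Frd → Type} {realify : Frd → Frd} {Strip : Type}
      {IsoS : Strip → Strip → Type} {Mv : ∀ v : (thetaIndex (pilotDataOfK T.D T.K)).V, v ∈ (thetaIndex (pilotDataOfK T.D T.K)).Vbad → Type}
      [∀ v h, Monoid (Mv v h)]
      (sig : GlobalLGPFrobenioidSignature (thetaIndex (pilotDataOfK T.D T.K)).lstar (thetaIndex (pilotDataOfK T.D T.K)).V
        (· ∈ (thetaIndex (pilotDataOfK T.D T.K)).Vbad) Frd IsoF Ob realify Strip IsoS Mv)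
      (split : SplittingMonoids Mv) {ObΔ : Type}
      {N : ∀ v : (thetaIndex (pilotDataOfK T.D T.K)).V, v ∈ (thetaIndex (pilotDataOfK T.D T.K)).Vbad → Type}
      [∀ v h, Monoid (N v h)] (qData : QPilotData ObΔ N)
      (qK : ∀ v : (thetaIndex (pilotDataOfK T.D T.K)).V, v ∈ (thetaIndex (pilotDataOfK T.D T.K)).Vbad →
        Set ((logShellsDH (pilotDataOfK T.D T.K) (analyticLogv T.K)).StarPacket v)),
    ¬ Cor312Vol.PilotKummerCompatHull
        (LatticeSituation.ofShells (logShellsDH (pilotDataOfK T.D T.K) (analyticLogv T.K)) M archPk archSub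
          (summandPiecesPr (pilotDataOfK T.D T.K) (logvAnalytic_analyticLogv (F := T.K))).Adm
          (summandPiecesPr (pilotDataOfK T.D T.K) (logvAnalytic_analyticLogv (F := T.K))).logvol Ψ act Mmod region frobAdm
          frobLogvol frobΨ frobMmod unitImage ballImage thetaDiv)
        (settingPrVolSharp (pilotDataOfK T.D T.K) (logvAnalytic_analyticLogv (F := T.K)) M archPk archSub Ψ act Mmod region n
          lat sig split qData (exists_realising_qIdeles_pilotDataOfK T.D).choose (exists_realising_thetaIdeles_pilotDataOfK T.D).choose
          (exists_realising_qIdeles_pilotDataOfK T.D).choose_spec.1 (exists_realising_qIdeles_pilotDataOfK T.D).choose_spec.2.1)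
        (fun _ => Cor312.Setting.qRegion
          (settingPrVolSharp (pilotDataOfK T.D T.K) (logvAnalytic_analyticLogv (F := T.K)) M archPk archSub Ψ act Mmod region n
            lat sig split qData (exists_realising_qIdeles_pilotDataOfK T.D).choose (exists_realising_thetaIdeles_pilotDataOfK T.D).choose
            (exists_realising_qIdeles_pilotDataOfK T.D).choose_spec.1 (exists_realising_qIdeles_pilotDataOfK T.D).choose_spec.2.1))
        qK :=
  GenuineK.not_pilotKummerCompatHull_lamSeven_of_ramification_le_sharp (k := 12) (l := 11) (n := 3) (E := 30 * 11) (by norm_num)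
    (by norm_num) le_rfl sharp_criterion_twelve_eleven.1 sharp_criterion_twelve_eleven.2 T
    (GenuineK.absRamificationIdx_kOf_le_thirty_mul_lamSeven (by norm_num) le_rfl T)

end Summit.ABC.IUTFork.Conditional.HexLocalType

end
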